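import Literature.Topology.FourManifolds.HCobordismTransitivity
import Literature.Topology.FourManifolds.WallStabilisation
import Literature.Topology.FourManifolds.ThetaFour
import Literature.Topology.FourManifolds.SphereSimplyConnected
import HarnessLib

/-!
# Transitivity of h-cobordism in dimension 4, supplied to its users: any two homotopy
# 4-spheres are h-cobordant (given `Θ₄ = 0`) and stably diffeomorphic (given also Wall's Thm. 3)

Topic `Literature/Topology/FourManifolds`; corollaries of `IsHCobordant.trans_succ`
(`HCobordismTransitivity.lean`: h-cobordism of closed smooth manifolds of positive dimension is
transitive — Kervaire–Milnor, *Groups of homotopy spheres I*, Ann. of Math. 77 (1963), §1, p. 504;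
Milnor, *Lectures on the h-cobordism theorem* (1965), Thm. 1.4).  Two theorems of the tree take
transitivity as the hypothesis `htrans : IsHCobordant.trans (n := 4) …` (the named fact of
`Cobordism.lean`, instantiated at closed smooth 4-manifolds); this file discharges that hypothesis:

* `IsHCobordant.trans_four` — the named fact `IsHCobordant.trans` at `n = 4` for closed smooth
  4-manifolds (Hausdorff, second countable, compact, `C^∞`), by `IsHCobordant.trans_succ`;
* `HomotopySphere.isHCobordant_of_theta_four'` — **any two homotopy 4-spheres are h-cobordant**,
  GIVEN only `Θ₄ = 0` (`isHCobordant_sphere_of_homotopySphere_four`, Kervaire–Milnor 1963, table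
  p. 504): `ThetaFour.lean`'s `HomotopySphere.isHCobordant_of_theta_four` without `htrans`;
* `HomotopySphere.exists_isStabilization'` — **any two homotopy 4-spheres are stably
  diffeomorphic**, GIVEN Wall's Thm. 3 (`exists_isStabilization_of_isHCobordant`) and `Θ₄ = 0`:
  `WallStabilisation.lean`'s `HomotopySphere.exists_isStabilization` without `htrans` and without
  its hypothesis "`S⁴` is simply connected" (the tree's theorem
  `simplyConnectedSpace_sphere_four_holds`, `SphereSimplyConnected.lean`).

Everything here is proved; no definition and no named fact is introduced.

## References

* M. Kervaire, J. Milnor, *Groups of homotopy spheres I*, Ann. of Math. (2) 77 (1963), §1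
  (p. 504), table p. 504. [KervaireMilnorAnnals1963]
* J. Milnor, *Lectures on the h-cobordism theorem* (1965), §1, Thm. 1.4. [MilnorHCobordism1965]
* C. T. C. Wall, *On simply-connected 4-manifolds*, J. London Math. Soc. 39 (1964), Thm. 3.
  [WallJLMS1964]
-/

noncomputable section

open scoped Manifold ContDiff

namespace Literature.Topology.FourManifolds

/-- **h-cobordism of closed smooth 4-manifolds is transitive**: the named fact
`IsHCobordant.trans` (`Cobordism.lean`) at `n = 4`, for closed smooth 4-manifolds (Hausdorff,
second countable, compact, `C^∞` on `ℝ⁴`), from `IsHCobordant.trans_succ` (Kervaire–Milnor 1963,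
§1, p. 504; Milnor 1965, Thm. 1.4). [cite: KervaireMilnorAnnals1963, §1 (p. 504)] [cite: MilnorHCobordism1965, §1, Thm. 1.4] -/
theorem IsHCobordant.trans_four {M N P : Type} [TopologicalSpace M] [T2Space M]
    [SecondCountableTopology M] [ChartedSpace (EuclideanSpace ℝ (Fin 4)) M] [IsManifold (𝓡 4) ∞ M]
    [CompactSpace M] [TopologicalSpace N] [ChartedSpace (EuclideanSpace ℝ (Fin 4)) N]
    [IsManifold (𝓡 4) ∞ N] [CompactSpace N] [TopologicalSpace P]
    [ChartedSpace (EuclideanSpace ℝ (Fin 4)) P] [IsManifold (𝓡 4) ∞ P] [CompactSpace P] :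
    IsHCobordant.trans (n := 4) (M := M) (N := N) (P := P) :=
  fun h₁ h₂ => IsHCobordant.trans_succ (n := 3) h₁ h₂

/-- **Any two homotopy 4-spheres are h-cobordant**, GIVEN `Θ₄ = 0`
(`isHCobordant_sphere_of_homotopySphere_four`: every homotopy 4-sphere is h-cobordant to `S⁴`,
Kervaire–Milnor 1963, table p. 504): `Σ ∼ₕ S⁴ ∼ₕ Σ'` by symmetry (`IsHCobordant.symm`) and
transitivity (`IsHCobordant.trans_four`) of h-cobordism.  This is `ThetaFour.lean`'s
`HomotopySphere.isHCobordant_of_theta_four` with its transitivity hypothesis discharged.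
[cite: KervaireMilnorAnnals1963, §1 (p. 504) and table p. 504] -/
theorem HomotopySphere.isHCobordant_of_theta_four'
    (h : isHCobordant_sphere_of_homotopySphere_four) (S T : HomotopySphere 4) :
    S.IsHCobordant T :=
  HomotopySphere.isHCobordant_of_theta_four h S T IsHCobordant.trans_four

/-- **Any two homotopy 4-spheres are stably diffeomorphic** (`Σ # k(S² × S²) ≅ Σ' # k(S² × S²)`
for some `k`, in the relational form: a common `k`-fold stabilisation `P`), GIVEN Wall's Thm. 3
(`exists_isStabilization_of_isHCobordant`: h-cobordant simply connected closed smooth 4-manifolds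
are stably diffeomorphic, Wall 1964) and `Θ₄ = 0` (`isHCobordant_sphere_of_homotopySphere_four`).
This is `WallStabilisation.lean`'s `HomotopySphere.exists_isStabilization` with its transitivity
hypothesis discharged by `IsHCobordant.trans_four` and the simple connectivity of `S⁴` by the
tree's `simplyConnectedSpace_sphere_four_holds`. [cite: WallJLMS1964, Thm. 3] [cite: KervaireMilnorAnnals1963, §1 (p. 504) and table p. 504] -/
theorem HomotopySphere.exists_isStabilization'
    (hW : exists_isStabilization_of_isHCobordant)
    (hΘ : isHCobordant_sphere_of_homotopySphere_four) (S T : HomotopySphere 4) :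
    ∃ (k : ℕ) (P : Type) (_ : TopologicalSpace P) (_ : T2Space P)
      (_ : SecondCountableTopology P) (_ : ChartedSpace (EuclideanSpace ℝ (Fin 4)) P)
      (_ : CompactSpace P) (_ : IsManifold (𝓡 4) ∞ P),
      IsStabilization k S.carrier P ∧ IsStabilization k T.carrier P :=
  HomotopySphere.exists_isStabilization hW hΘ simplyConnectedSpace_sphere_four_holds S T
    IsHCobordant.trans_four

end Literature.Topology.FourManifolds

end
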